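import Literature.NumberTheory.DiophantineGeometry.ValuationProductElliptic
import Literature.NumberTheory.DiophantineGeometry.ConductorRadicalProofs
import Literature.NumberTheory.DiophantineGeometry.AbcWave0
import HarnessLib

/-!
# Counting level-lowering primes of a semistable elliptic curve (Pasten 2024, Cor 16.6 / Thm 1.13)

Topic `Literature/NumberTheory/EllipticCurves` (family `abc`). H. Pasten, *Shimura curves and the abc
conjecture*, J. Number Theory **254** (2024) 214–335 = arXiv:1705.09251 [`PastenShimura2024`]
(held TeX text; §1.4 p. 8 and §16.3 pp. 50–51 of the arXiv version read; arXiv numbering as in the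
sibling files):

> For an elliptic curve `E` over `ℚ`, let
> `L(E) := {ℓ prime : ∃ p prime such that p ∣ N_E and ℓ ∣ v_p(Δ_E)}`.
>
> **Corollary 16.6** (Counting level-lowering primes). *Let `ε > 0`. Then for all semi-stable elliptic
> curves `E` over `ℚ` we have `#L(E) < (11/2 + ε) log N_E / log log N_E + O_ε(1)`.*
>
> **Theorem 1.13** (= the introduction's form). *There is a constant `c` such that for all semi-stable
> elliptic curves `E` over `ℚ` we have `#L(E) < 6 log N_E / log log N_E + c`.*

("this theory [Ribet's level lowering] applies to primes `ℓ` dividing some exponent in the prime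
factorization of `Δ_E` … it is interesting to know how many of these primes can an elliptic curve
have. It turns out that not too many", p. 8.) Printed proof of Cor 16.6: `Λ(E) := ∏_{ℓ ∈ L(E)} ℓ`
divides `∏_{p ∣ N_E} v_p(Δ_E) < K_ε N_E^{11/2+ε}` (Thm 16.5, first part = Thm 1.12, the tree's named
fact `Literature.NumberTheory.DiophantineGeometry.pastenShimura2024_thm_1_12`), and "`log Λ(E)` is
bigger than or equal to the sum of `log p` where `p` runs over the first `#L(E)` prime numbers, [so]
the result now follows from the prime number theorem."

## Contents

* `WeierstrassCurve.levelLoweringPrimes W` — the finite set `L(E)` (a real definition: the primes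
  dividing `v_p(Δ_min)` for some prime `p ∣ N_E`), with `mem_levelLoweringPrimes`.
* `WeierstrassCurve.prod_levelLoweringPrimes_dvd` — PROVED: `Λ(E) ∣ ∏_{p ∣ N_E} v_p(Δ_E)` (first
  sentence of the printed proof; uses `radical_conductorNorm_eq_holds`: `N_E` and `Δ_E` have the same
  prime factors, so every `v_p(Δ_E)`, `p ∣ N_E`, is `≥ 1`).
* `PastenShimura2024_cor_16_6` — Cor 16.6 as printed (named fact, D-0014; its residual content over
  the tree is Thm 1.12 plus a Chebyshev/PNT lower bound for the product of `k` distinct primes).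
* `PastenShimura2024_thm_1_13` — Thm 1.13, PROVED from Cor 16.6 (`ε = 1/2`).

Rendering: `E/ℚ` is `W : WeierstrassCurve ℚ` with `[W.IsElliptic]`; "semi-stable" = squarefree
conductor (`Squarefree (W.conductorNorm ℤ)`, as in `pastenShimura2024_thm_1_12`);
`v_p(Δ_E) = (W.minimalDiscriminantNorm ℤ).factorization p`; `O_ε(1)` = a constant `C` depending on
`ε`; `log log N_E > 0` since `N_E ≥ 11`.

## References

* [PastenShimura2024] H. Pasten, J. Number Theory 254 (2024) = arXiv:1705.09251: §1.4 Thm 1.13 and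
  the definition of `L(E)` (p. 8); §16.3 Thm 16.5, Cor 16.6 (pp. 50–51).
* [RibetInv100] K. Ribet, Invent. Math. 100 (1990) (level lowering), as cited there.
-/

noncomputable section

open UniqueFactorizationMonoid

namespace WeierstrassCurve

variable (W : WeierstrassCurve ℚ)

/-- **`L(E)`, the level-lowering primes of `E/ℚ`** (Pasten 2024, §1.4 p. 8 and §16.3):
`L(E) = {ℓ prime : ∃ p prime, p ∣ N_E, ℓ ∣ v_p(Δ_E)}`, as the finite set of primes dividing the
exponent `v_p(Δ_min)` of some prime `p ∣ N_E` (`N_E = W.conductorNorm ℤ`,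
`|Δ_min| = W.minimalDiscriminantNorm ℤ`). (Dot-notation extension of Mathlib's `WeierstrassCurve`.)
[cite: PastenShimura2024, §1.4 Thm 1.13 (definition of L(E), arXiv p. 8)] -/
def levelLoweringPrimes : Finset ℕ :=
  (W.conductorNorm ℤ).primeFactors.biUnion fun p =>
    ((W.minimalDiscriminantNorm ℤ).factorization p).primeFactors

/-- Membership in `L(E)`: `ℓ ∈ L(E)` iff `ℓ` is a prime factor of `v_p(Δ_E)` for some prime factor `p`
of `N_E` (unfolding lemma). [cite: PastenShimura2024, §1.4 (definition of L(E))] -/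
theorem mem_levelLoweringPrimes {ℓ : ℕ} :
    ℓ ∈ W.levelLoweringPrimes ↔ ∃ p ∈ (W.conductorNorm ℤ).primeFactors,
      ℓ ∈ ((W.minimalDiscriminantNorm ℤ).factorization p).primeFactors := by
  simp [levelLoweringPrimes]

/-- Every element of `L(E)` is prime. [cite: PastenShimura2024, §1.4 (definition of L(E))] -/
theorem prime_of_mem_levelLoweringPrimes {ℓ : ℕ} (h : ℓ ∈ W.levelLoweringPrimes) : ℓ.Prime := by
  obtain ⟨p, -, hℓ⟩ := (W.mem_levelLoweringPrimes).mp h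
  exact Nat.prime_of_mem_primeFactors hℓ

/-- **`Λ(E) = ∏_{ℓ ∈ L(E)} ℓ` divides `∏_{p ∣ N_E} v_p(Δ_E)`** (Pasten 2024, proof of Cor 16.6, first
sentence; PROVED): each `ℓ ∈ L(E)` divides some factor `v_p(Δ_E)`, all factors are `≥ 1` because
`N_E` and `Δ_E` have the same prime divisors (`radical_conductorNorm_eq_holds`), and distinct primes
dividing a number have their product dividing it. [cite: PastenShimura2024, Cor 16.6 (proof, arXiv p. 51)] -/
theorem prod_levelLoweringPrimes_dvd [W.IsElliptic] :
    ∏ ℓ ∈ W.levelLoweringPrimes, ℓ ∣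
      ∏ p ∈ (W.conductorNorm ℤ).primeFactors, (W.minimalDiscriminantNorm ℤ).factorization p := by
  refine Finset.prod_primes_dvd _ (fun ℓ hℓ => Nat.prime_iff.mp (W.prime_of_mem_levelLoweringPrimes hℓ))
    fun ℓ hℓ => ?_
  obtain ⟨p, hp, hℓp⟩ := (W.mem_levelLoweringPrimes).mp hℓ
  exact (Nat.dvd_of_mem_primeFactors hℓp).trans (Finset.dvd_prod_of_mem _ hp)

/-- Each factor `v_p(Δ_E)`, `p ∣ N_E`, is positive: the conductor and the minimal discriminant have
the same prime factors (`radical_conductorNorm_eq_holds`). [cite: SilvermanAEC2009, VIII.11 (p. 221)] -/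
theorem factorization_minimalDiscriminantNorm_pos_of_mem [W.IsElliptic] {p : ℕ}
    (hp : p ∈ (W.conductorNorm ℤ).primeFactors) :
    0 < (W.minimalDiscriminantNorm ℤ).factorization p := by
  have hrad := W.radical_conductorNorm_eq_holds
  rw [Literature.NumberTheory.DiophantineGeometry.natRadical_eq_iff] at hrad
  rw [hrad] at hp
  obtain ⟨hpr, hdvd, hne⟩ := Nat.mem_primeFactors.mp hp
  exact hpr.factorization_pos_of_dvd hne hdvd

/-- Hence `Λ(E) ≤ ∏_{p ∣ N_E} v_p(Δ_E)` (the product is positive).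
[cite: PastenShimura2024, Cor 16.6 (proof, arXiv p. 51)] -/
theorem prod_levelLoweringPrimes_le [W.IsElliptic] :
    ∏ ℓ ∈ W.levelLoweringPrimes, ℓ ≤
      ∏ p ∈ (W.conductorNorm ℤ).primeFactors, (W.minimalDiscriminantNorm ℤ).factorization p :=
  Nat.le_of_dvd (Finset.prod_pos fun _ hp => W.factorization_minimalDiscriminantNorm_pos_of_mem hp)
    W.prod_levelLoweringPrimes_dvd

end WeierstrassCurve

namespace Literature.NumberTheory.EllipticCurves

open WeierstrassCurve

/-- **Pasten 2024, Corollary 16.6 (Counting level-lowering primes).** "Let `ε > 0`. Then for all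
semi-stable elliptic curves `E` over `ℚ` we have `#L(E) < (11/2 + ε) log N_E / log log N_E + O_ε(1)`."
Rendered: semistable = squarefree conductor; `O_ε(1)` = a constant `C` depending on `ε`. Printed
proof: `Λ(E) ∣ ∏_{p∣N_E} v_p(Δ_E)` (`WeierstrassCurve.prod_levelLoweringPrimes_dvd`, PROVED), Thm 16.5
= Thm 1.12 (`Literature.NumberTheory.DiophantineGeometry.pastenShimura2024_thm_1_12`, named fact) and
the prime number theorem (a Chebyshev lower bound for the product of the first `k` primes suffices).
Named fact (D-0014). [cite: PastenShimura2024, Cor 16.6 (arXiv numbering, p. 51)] -/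
def PastenShimura2024_cor_16_6 : Prop :=
  ∀ ε : ℝ, 0 < ε → ∃ C : ℝ, ∀ (W : WeierstrassCurve ℚ) [W.IsElliptic],
    Squarefree (W.conductorNorm ℤ) →
      (W.levelLoweringPrimes.card : ℝ) <
        (11 / 2 + ε) * Real.log (W.conductorNorm ℤ) / Real.log (Real.log (W.conductorNorm ℤ)) + C

/-- **Pasten 2024, Theorem 1.13** (Counting level-lowering primes, the introduction's form): "There is
a constant `c` such that for all semi-stable elliptic curves `E` over `ℚ` we have
`#L(E) < 6 log N_E / log log N_E + c`." PROVED from Cor 16.6 with `ε = 1/2`.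
[cite: PastenShimura2024, Thm 1.13 (arXiv p. 8)] -/
theorem PastenShimura2024_thm_1_13 (h : PastenShimura2024_cor_16_6) :
    ∃ c : ℝ, ∀ (W : WeierstrassCurve ℚ) [W.IsElliptic], Squarefree (W.conductorNorm ℤ) →
      (W.levelLoweringPrimes.card : ℝ) <
        6 * Real.log (W.conductorNorm ℤ) / Real.log (Real.log (W.conductorNorm ℤ)) + c := by
  obtain ⟨C, hC⟩ := h (1 / 2) (by norm_num)
  refine ⟨C, fun W _ hsq => ?_⟩
  have := hC W hsq
  norm_num at this
  exact this

end Literature.NumberTheory.EllipticCurves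

end
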